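import Summits.NavierStokesRegularity.NavierStokesRegularity.Theses.RellichScar
import Summits.NavierStokesRegularity.NavierStokesRegularity.Theorems.ScarRigidity.Negative.LogicAndLoadBearing
import Literature.Analysis.FluidPDE.TypeIAncientMild
import Literature.Analysis.FluidPDE.ParasiticSlabFlow
import Summits.NavierStokesRegularity.NavierStokesRegularity.Theorems.RellichScarScarRigidityApexBoundsPressure
import Literature.Analysis.FluidPDE.ClassicalSolutionGlue
import Literature.Analysis.FluidPDE.ClassicalSolutionRescale
import HarnessLib

/-!
# `ScarRigidity` — line `finite-energy-log-convexity`, stub `stub_apexDerivativeBounds`: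
# assembly (crux stmt-NavierStokesRegularity-11717, route RellichScar)

**S1β (the provable form).** A Type-I ancient mild field in the Oseen gauge with the apex bound
(`IsTypeIAncientMild C V`, `HasTypeIDecay C V`) is a classical Navier–Stokes solution on the
whole open slab `(-∞, 0) × ℝ³` for a jointly smooth pressure `Q` (the window pressures of
Fabes–Jones–Rivière, `IsTypeIAncientMild.exists_isClassicalNSSolutionOn_Ioo`, normalised by
`Q(t, 0) = 0` and glued), and with ONE constant `L = L(C)`:

  `‖∇V‖ ≤ L/(‖x‖+√(-t))²`, `‖D²V‖, ‖∂ₜV‖, ‖∇Q‖ ≤ L/(‖x‖+√(-t))³`  (`t < 0`, all `x`).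

The velocity bounds are `exists_norm_iteratedFDeriv_le_apex` (core: KNSS smoothing + scaling;
far: local Leray theory + Jia–Šverák's a priori estimate + quantitative higher regularity); the
pressure-gradient bound is the unit-scale estimate `exists_unit_pressure_gradient_bound`
transported by the two zooms (`c = ‖x‖` off the axis, `c = √(-t)` in the core) — the gradient of
a classical pressure being canonical and zoom-covariant (`IsClassicalNSSolutionOn.stRescale`);
the time derivative is read off the momentum equation.

What is NOT provided here is the fifth clause of the registered stub, `|Q| ≤ L/(‖x‖+√(-t))²`,
which forces the Leray gauge `Q → 0` at spatial infinity: the joint `C^∞` regularity of the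
Leray-gauge pressure needs the spatial decay of all time derivatives of `V`, which the tree does
not supply; the gauge-free content (`∇Q` and its decay, whence `Q(t, ·)` has a limit `a(t)` at
infinity with `|Q - a(t)| ≤ L/(2(‖x‖+√(-t))²)`) is what the bounds above carry.
-/

noncomputable section

open Set Filter Function MeasureTheory Metric TopologicalSpace
open scoped Topology ENNReal NNReal InnerProductSpace RealInnerProductSpace
open Literature.Analysis.FluidPDE
open Summit.NavierStokesRegularity.NavierStokesRegularity.Theses.RellichScar
open Summit.NavierStokesRegularity.NavierStokesRegularity.Theorems.ScarRigidity.Negative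

set_option linter.dupNamespace false

namespace Summit.NavierStokesRegularity.NavierStokesRegularity.Theorems.RellichScarScarRigidity

open Literature.Analysis
open scoped Laplacian

/-! ## A jointly smooth pressure on the whole slab -/

section WholeSlab

variable {C : ℝ} {V : ℝ → (EuclideanSpace ℝ (Fin 3)) → (EuclideanSpace ℝ (Fin 3))}

/-- **A Type-I ancient mild field is classical on the whole open slab** `(-∞, 0) × ℝ³` for a
jointly smooth pressure: the window pressures on `(-(n+2), 0)` (Fabes–Jones–Rivière via
`exists_isClassicalNSSolutionOn_Ioo`), normalised by their value at the spatial origin, agree on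
overlaps (`pressure_sub_apply_zero_eq_of_eventuallyEq`: the velocity determines `∇p`), hence
define one smooth pressure. [cite: FabesJonesRiviere1972, Thm. 2.1] -/
theorem exists_isClassicalNSSolutionOn_Iio (hV : IsTypeIAncientMild C V) :
    ∃ Q : ℝ → (EuclideanSpace ℝ (Fin 3)) → ℝ, IsClassicalNSSolutionOn (Iio (0 : ℝ)) 1 0 V Q := by
  -- the window pressures
  have hex : ∀ n : ℕ, ∃ p : ℝ → (EuclideanSpace ℝ (Fin 3)) → ℝ, IsClassicalNSSolutionOn (Ioo (-(n : ℝ) - 2) 0) 1 0 V p :=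
    fun n => hV.exists_isClassicalNSSolutionOn_Ioo (t₀ := -(n : ℝ) - 2)
      (by linarith [(Nat.cast_nonneg n : (0 : ℝ) ≤ n)])
  choose p hp using hex
  -- the index of a time and its window
  set N : ℝ → ℕ := fun t => Nat.floor (-t) with hN
  have hwin : ∀ t < 0, t ∈ Ioo (-(N t : ℝ) - 2) 0 := by
    intro t ht
    refine ⟨?_, ht⟩
    have h1 : -t < (Nat.floor (-t) : ℝ) + 1 := Nat.lt_floor_add_one (-t)
    show -((Nat.floor (-t) : ℕ) : ℝ) - 2 < t
    linarith
  -- the glued normalised pressure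
  set Q : ℝ → (EuclideanSpace ℝ (Fin 3)) → ℝ := fun t x => p (N t) t x - p (N t) t 0 with hQ
  -- agreement with every window pressure on its window
  have hagree : ∀ (m : ℕ) (t : ℝ), t ∈ Ioo (-(m : ℝ) - 2) 0 → ∀ x, Q t x = p m t x - p m t 0 := by
    intro m t ht x
    have ht0 : t < 0 := ht.2
    exact (hp (N t)).pressure_sub_apply_zero_eq_of_eventuallyEq (hp m)
      (isOpen_Ioo.mem_nhds (hwin t ht0)) (isOpen_Ioo.mem_nhds ht) (Eventually.of_forall fun _ => rfl) x
  refine ⟨Q, ⟨hV.contDiffOn, ?_, fun t ht x => ?_, fun t ht => hV.isDivFree ht⟩⟩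
  · -- joint smoothness, locally on the windows
    refine contDiffOn_of_locally_contDiffOn fun z hz => ?_
    obtain ⟨t, x⟩ := z
    have ht : t < 0 := hz.1
    refine ⟨Ioo (-(N t : ℝ) - 2) 0 ×ˢ univ, isOpen_Ioo.prod isOpen_univ, ⟨hwin t ht, mem_univ _⟩, ?_⟩
    have hsub : (Iio (0 : ℝ) ×ˢ (univ : Set (EuclideanSpace ℝ (Fin 3)))) ∩ Ioo (-(N t : ℝ) - 2) 0 ×ˢ univ =
        Ioo (-(N t : ℝ) - 2) 0 ×ˢ univ := by
      rw [prod_inter_prod, inter_univ, inter_eq_right.2 Ioo_subset_Iio_self]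
    rw [hsub]
    have hsm : IsSmoothSpaceTimeOn (Ioo (-(N t : ℝ) - 2) 0) fun s y => p (N t) s y - p (N t) s 0 :=
      (hp (N t)).smooth_pressure.sub_apply_zero
    refine (hsm : ContDiffOn ℝ _ _ _).congr fun w hw => ?_
    exact hagree (N t) w.1 hw.1 w.2
  · -- the momentum equation at `t < 0`
    have hw := hwin t ht
    have hm := (hp (N t)).momentum t hw x
    rw [timeDerivWithin_eq_deriv_of_isOpen_subset isOpen_Ioo subset_rfl hw] at hm
    rw [timeDerivWithin_eq_deriv_of_isOpen_subset isOpen_Iio subset_rfl ht]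
    have hg : gradient (Q t) x = gradient (p (N t) t) x := gradient_sub_const _ _ _
    rw [hg]
    exact hm

end WholeSlab

/-! ## The pressure gradient on the slab -/

section Gradient

variable {C : ℝ} {V : ℝ → (EuclideanSpace ℝ (Fin 3)) → (EuclideanSpace ℝ (Fin 3))} {Q : ℝ → (EuclideanSpace ℝ (Fin 3)) → ℝ}

/-- **Zoom covariance of classical solutions on the slab**: for `c > 0`, the pair
`(c V(c²·, c·), c² Q(c²·, c·))` is again a classical solution on `(-∞, 0)` (Leray's similarity,
`IsClassicalNSSolutionOn.stRescale`). [cite: Leray1934, §20] -/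
theorem isClassicalNSSolutionOn_zoom (hQ : IsClassicalNSSolutionOn (Iio (0 : ℝ)) 1 0 V Q) {c : ℝ}
    (hc : 0 < c) :
    IsClassicalNSSolutionOn (Iio (0 : ℝ)) 1 0 (c • stPull (c ^ 2) c 0 0 V) (c ^ 2 • stPull (c ^ 2) c 0 0 Q) := by
  have h := hQ.stRescale hc hc (show c ^ 2 = c * c by ring) 0 0
  have hset : (fun r : ℝ => 0 + c ^ 2 * r) ⁻¹' Iio 0 = Iio 0 := by
    ext r
    simp only [mem_preimage, mem_Iio, zero_add]
    constructor
    · intro hr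
      by_contra hge
      rw [not_lt] at hge
      exact absurd hr (not_lt.2 (mul_nonneg (sq_nonneg c) hge))
    · intro hr
      exact mul_neg_of_pos_of_neg (pow_pos hc 2) hr
  have hvisc : c * 1 / c = 1 := by field_simp
  rw [hset, hvisc, smul_stPull_zero] at h
  exact h

/-- **Zoom covariance of the pressure gradient**: `‖∇Q(t)(x)‖ = c⁻³ ‖∇Q_c(c⁻²t)(c⁻¹x)‖` for
the zoomed pressure `Q_c = c² Q(c²·, c·)`. [folklore] -/
theorem norm_gradient_le_of_zoom (hQ : IsClassicalNSSolutionOn (Iio (0 : ℝ)) 1 0 V Q) {c : ℝ}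
    (hc : 0 < c) {t : ℝ} (ht : t < 0) (x : (EuclideanSpace ℝ (Fin 3))) {K : ℝ}
    (hK : ‖gradient ((c ^ 2 • stPull (c ^ 2) c 0 0 Q) ((c ^ 2)⁻¹ * t)) (c⁻¹ • x)‖ ≤ K) :
    ‖gradient (Q t) x‖ ≤ K / c ^ 3 := by
  have hc2 : c ^ 2 ≠ 0 := pow_ne_zero 2 hc.ne'
  have ht' : 0 + c ^ 2 * ((c ^ 2)⁻¹ * t) = t := by rw [zero_add, ← mul_assoc, mul_inv_cancel₀ hc2, one_mul]
  have hx' : (0 : (EuclideanSpace ℝ (Fin 3))) + c • c⁻¹ • x = x := by rw [zero_add, smul_smul, mul_inv_cancel₀ hc.ne', one_smul]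
  have hdQ : Differentiable ℝ (Q t) := (hQ.contDiff_pressure ht).differentiable (by simp)
  -- the zoomed slice and its derivative at `c⁻¹ x`
  have hslice : (c ^ 2 • stPull (c ^ 2) c 0 0 Q) ((c ^ 2)⁻¹ * t) =
      fun y => c ^ 2 • stPull (c ^ 2) c 0 0 Q ((c ^ 2)⁻¹ * t) y := rfl
  have hdst : Differentiable ℝ (stPull (c ^ 2) c 0 0 Q ((c ^ 2)⁻¹ * t)) :=
    differentiable_stPull_slice (by rw [ht']; exact hdQ)
  have hfd : fderiv ℝ ((c ^ 2 • stPull (c ^ 2) c 0 0 Q) ((c ^ 2)⁻¹ * t)) (c⁻¹ • x) =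
      c ^ 2 • (c • fderiv ℝ (Q t) x) := by
    rw [hslice, fderiv_fun_const_smul (hdst _), fderiv_stPull, ht', hx']
  have hnorm : ‖gradient ((c ^ 2 • stPull (c ^ 2) c 0 0 Q) ((c ^ 2)⁻¹ * t)) (c⁻¹ • x)‖ =
      c ^ 3 * ‖gradient (Q t) x‖ := by
    rw [gradient, LinearIsometryEquiv.norm_map, hfd, norm_smul, norm_smul, gradient,
      LinearIsometryEquiv.norm_map, Real.norm_of_nonneg (sq_nonneg c), Real.norm_of_nonneg hc.le]
    ring
  rw [hnorm] at hK
  rw [le_div_iff₀ (pow_pos hc 3), mul_comm]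
  exact hK

/-- **The apex-weighted pressure-gradient bound**: one constant `L = L(C)` with
`‖∇Q(t)(x)‖ ≤ L/(‖x‖ + √(-t))³` for all `t < 0`, all `x`, every apex profile `V` of constant `C`
and EVERY classical pressure `Q` of `V` on the slab (the unit-scale bound
`exists_unit_pressure_gradient_bound` at the zooms `c = ‖x‖` and `c = √(-t)`).
[cite: KangMiuraTsai2020, Lemma 3.4 (pressure decomposition), arXiv:1812.10509 p. 8] -/
theorem exists_norm_gradient_le_apex (C : ℝ) :
    ∃ L : ℝ, 0 ≤ L ∧ ∀ ⦃V : ℝ → (EuclideanSpace ℝ (Fin 3)) → (EuclideanSpace ℝ (Fin 3))⦄, IsTypeIAncientMild C V → HasTypeIDecay C V →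
      ∀ ⦃Q : ℝ → (EuclideanSpace ℝ (Fin 3)) → ℝ⦄, IsClassicalNSSolutionOn (Iio (0 : ℝ)) 1 0 V Q →
        ∀ t < 0, ∀ x : (EuclideanSpace ℝ (Fin 3)), ‖gradient (Q t) x‖ ≤ L / (‖x‖ + Real.sqrt (-t)) ^ 3 := by
  obtain ⟨Kp, hKp⟩ := exists_unit_pressure_gradient_bound C
  set K : ℝ := max Kp 0 with hKdef
  have hK0 : 0 ≤ K := le_max_right _ _
  refine ⟨2 ^ 3 * (K + K), by positivity, fun V hV hd Q hQ t ht x => ?_⟩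
  have hC : 0 ≤ C := hV.nonneg
  -- the core zoom `c = √(-t)`
  have hcore : ‖gradient (Q t) x‖ ≤ K / Real.sqrt (-t) ^ 3 := by
    set c : ℝ := Real.sqrt (-t) with hcdef
    have hc : 0 < c := Real.sqrt_pos.2 (neg_pos.2 ht)
    have hc2 : c ^ 2 = -t := Real.sq_sqrt (neg_pos.2 ht).le
    have hs' : (c ^ 2)⁻¹ * t = -1 := by
      rw [hc2, inv_mul_eq_div, div_neg, div_self ht.ne]
    have hW := isTypeIAncientMild_zoom hV hc (0 : (EuclideanSpace ℝ (Fin 3)))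
    have hWd := hasTypeIDecay_zoom hd hc
    have hQW := (isClassicalNSSolutionOn_zoom hQ hc).mono (Ioo_subset_Iio_self (a := (-2 : ℝ)))
      isOpen_Ioo.uniqueDiffOn
    have hMv : ∀ τ < (-1 : ℝ) / 2, ∀ y : (EuclideanSpace ℝ (Fin 3)), dist y (c⁻¹ • x) < 1 / 2 →
        ‖(c • stPull (c ^ 2) c 0 0 V) τ y‖ ≤ 2 * max C 0 := by
      intro τ hτ y _
      rw [max_eq_left hC]
      have hτ0 : τ < 0 := by linarith
      refine (hW.norm_le hτ0 y).trans ?_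
      have hsq : 1 / 2 ≤ Real.sqrt (-τ) := by
        refine Real.le_sqrt_of_sq_le ?_
        linarith
      rw [div_le_iff₀ (lt_of_lt_of_le (by norm_num) hsq)]
      nlinarith
    have h := hKp hW hWd (-1) (by norm_num) (c⁻¹ • x) hMv (-2) _ (by norm_num) hQW
    rw [← hs'] at h
    exact norm_gradient_le_of_zoom hQ hc ht x (h.trans (le_max_left _ _))
  -- the far zoom `c = ‖x‖`
  have hfar : x ≠ 0 → ‖gradient (Q t) x‖ ≤ K / ‖x‖ ^ 3 := by
    intro hx
    have hc : 0 < ‖x‖ := norm_pos_iff.2 hx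
    have hW := isTypeIAncientMild_zoom hV hc (0 : (EuclideanSpace ℝ (Fin 3)))
    have hWd := hasTypeIDecay_zoom hd hc
    set s' : ℝ := (‖x‖ ^ 2)⁻¹ * t with hs'
    have hs'0 : s' < 0 := mul_neg_of_pos_of_neg (inv_pos.2 (pow_pos hc 2)) ht
    have he : ‖‖x‖⁻¹ • x‖ = 1 := by
      rw [norm_smul, norm_inv, norm_norm, inv_mul_cancel₀ hc.ne']
    have hQW := (isClassicalNSSolutionOn_zoom hQ hc).mono (Ioo_subset_Iio_self (a := s' - 1))
      isOpen_Ioo.uniqueDiffOn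
    have hMv : ∀ τ < s' / 2, ∀ y : (EuclideanSpace ℝ (Fin 3)), dist y (‖x‖⁻¹ • x) < 1 / 2 →
        ‖(‖x‖ • stPull (‖x‖ ^ 2) ‖x‖ 0 0 V) τ y‖ ≤ 2 * max C 0 := by
      intro τ hτ y hy
      rw [max_eq_left hC]
      exact norm_le_two_mul_of_near_unit hWd hC (by linarith) he hy
    have h := hKp hW hWd s' hs'0 _ hMv (s' - 1) _ (by linarith) hQW
    exact norm_gradient_le_of_zoom hQ hc ht x (h.trans (le_max_left _ _))
  exact le_apex_weight_of_core_of_far hK0 hK0 ht 3 hcore hfar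

end Gradient

/-! ## The time derivative -/

/-- `‖Δf(x)‖ ≤ 3 ‖D²f(x)‖` on `ℝ³` (`Δ = Σᵢ D²[eᵢ, eᵢ]`). [folklore] -/
theorem norm_laplacian_le_three_mul {F : Type*} [NormedAddCommGroup F] [NormedSpace ℝ F]
    (f : (EuclideanSpace ℝ (Fin 3)) → F) (x : (EuclideanSpace ℝ (Fin 3))) : ‖(Δ f) x‖ ≤ 3 * ‖iteratedFDeriv ℝ 2 f x‖ := by
  rw [InnerProductSpace.laplacian_eq_iteratedFDeriv_orthonormalBasis f (EuclideanSpace.basisFun (Fin 3) ℝ)]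
  refine (norm_sum_le _ _).trans ?_
  have hterm : ∀ i : Fin 3, ‖iteratedFDeriv ℝ 2 f x
      ![(EuclideanSpace.basisFun (Fin 3) ℝ) i, (EuclideanSpace.basisFun (Fin 3) ℝ) i]‖ ≤
      ‖iteratedFDeriv ℝ 2 f x‖ := by
    intro i
    refine (ContinuousMultilinearMap.le_opNorm _ _).trans ?_
    rw [Fin.prod_univ_two]
    simp
  calc ∑ i, ‖iteratedFDeriv ℝ 2 f x
        ![(EuclideanSpace.basisFun (Fin 3) ℝ) i, (EuclideanSpace.basisFun (Fin 3) ℝ) i]‖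
      ≤ ∑ _i : Fin 3, ‖iteratedFDeriv ℝ 2 f x‖ := Finset.sum_le_sum fun i _ => hterm i
    _ = 3 * ‖iteratedFDeriv ℝ 2 f x‖ := by simp

/-- **The apex-weighted time-derivative bound**, read off the momentum equation
`∂ₜV = ΔV - (V·∇)V - ∇Q` and the bounds on `D²V`, `V`, `∇V`, `∇Q`. [folklore] -/
theorem exists_norm_deriv_le_apex (C : ℝ) :
    ∃ L : ℝ, 0 ≤ L ∧ ∀ ⦃V : ℝ → (EuclideanSpace ℝ (Fin 3)) → (EuclideanSpace ℝ (Fin 3))⦄, IsTypeIAncientMild C V → HasTypeIDecay C V →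
      ∀ ⦃Q : ℝ → (EuclideanSpace ℝ (Fin 3)) → ℝ⦄, IsClassicalNSSolutionOn (Iio (0 : ℝ)) 1 0 V Q →
        ∀ t < 0, ∀ x : (EuclideanSpace ℝ (Fin 3)), ‖deriv (fun s => V s x) t‖ ≤ L / (‖x‖ + Real.sqrt (-t)) ^ 3 := by
  obtain ⟨L₁, hL₁0, hL₁⟩ := exists_norm_iteratedFDeriv_le_apex C
  obtain ⟨L₂, hL₂0, hL₂⟩ := exists_norm_gradient_le_apex C
  refine ⟨3 * L₁ + L₁ * |C| + L₂, by positivity, fun V hV hd Q hQ t ht x => ?_⟩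
  have hC : 0 ≤ C := hV.nonneg
  set ρ : ℝ := ‖x‖ + Real.sqrt (-t) with hρ
  have hρ0 : 0 < ρ := add_pos_of_nonneg_of_pos (norm_nonneg _) (Real.sqrt_pos.2 (neg_pos.2 ht))
  -- the momentum equation at `(t, x)`
  have hm := hQ.momentum t ht x
  rw [timeDerivWithin_eq_deriv_of_isOpen_subset isOpen_Iio subset_rfl ht] at hm
  have hderiv : deriv (fun s => V s x) t =
      (1 : ℝ) • (Δ (V t)) x - gradient (Q t) x - convect (V t) (V t) x := by
    have hm' : deriv (fun s => V s x) t + convect (V t) (V t) x =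
        (1 : ℝ) • (Δ (V t)) x - gradient (Q t) x := by simpa using hm
    rw [← hm']; abel
  -- the three terms
  have h2 := hL₁ hV hd 2 (by norm_num) t ht x
  have h1 := hL₁ hV hd 1 (by norm_num) t ht x
  rw [norm_iteratedFDeriv_one] at h1
  have hlap : ‖(Δ (V t)) x‖ ≤ 3 * (L₁ / ρ ^ 3) :=
    (norm_laplacian_le_three_mul _ _).trans (mul_le_mul_of_nonneg_left h2 (by norm_num))
  have hgrad := hL₂ hV hd hQ t ht x
  have hconv : ‖convect (V t) (V t) x‖ ≤ L₁ / ρ ^ 2 * (C / ρ) := by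
    rw [convect_apply]
    exact (ContinuousLinearMap.le_opNorm _ _).trans
      (mul_le_mul h1 (hd t ht x) (norm_nonneg _) (div_nonneg hL₁0 (pow_nonneg hρ0.le _)))
  calc ‖deriv (fun s => V s x) t‖
      = ‖(1 : ℝ) • (Δ (V t)) x - gradient (Q t) x - convect (V t) (V t) x‖ := by rw [hderiv]
    _ ≤ ‖(1 : ℝ) • (Δ (V t)) x‖ + ‖gradient (Q t) x‖ + ‖convect (V t) (V t) x‖ :=
        (norm_sub_le _ _).trans (add_le_add_left (norm_sub_le _ _) _)
    _ ≤ 3 * (L₁ / ρ ^ 3) + L₂ / ρ ^ 3 + L₁ / ρ ^ 2 * (C / ρ) := by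
        rw [one_smul]; exact add_le_add (add_le_add hlap hgrad) hconv
    _ = (3 * L₁ + L₁ * C + L₂) / ρ ^ 3 := by field_simp; ring
    _ ≤ (3 * L₁ + L₁ * |C| + L₂) / ρ ^ 3 := by
        gcongr; exact le_abs_self C

/-! ## S1β, assembled -/

/-- **S1β in its provable (gauge-free) form.** For a Type-I ancient mild field `V` in the
Oseen gauge with the apex bound there are a jointly smooth pressure `Q` making `(V, Q)` a
classical Navier–Stokes solution on the open slab `(-∞, 0) × ℝ³`, and `L ≥ 0`, with
`‖∇V‖ ≤ L/(‖x‖+√(-t))²` and `‖D²V‖, ‖∂ₜV‖, ‖∇Q‖ ≤ L/(‖x‖+√(-t))³` for all `t < 0` and all `x`.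
(The clause `|Q| ≤ L/(‖x‖+√(-t))²` of the registered stub, which pins the Leray gauge, is not
part of this statement; see the module docstring.) [cite: KochNadirashviliSereginSverak2009, Prop. 4.1 (arXiv:0709.3599v1 p. 8)] [cite: SereginSverak2009, §2 p. 8] -/
theorem apexDerivativeBounds_gaugeFree :
    ∀ (V : ℝ → (EuclideanSpace ℝ (Fin 3)) → (EuclideanSpace ℝ (Fin 3))) (C : ℝ), 0 < C → IsTypeIAncientMild C V → HasTypeIDecay C V →
      ∃ (Q : ℝ → (EuclideanSpace ℝ (Fin 3)) → ℝ) (L : ℝ), 0 ≤ L ∧ IsClassicalNSSolutionOn (Iio (0 : ℝ)) 1 0 V Q ∧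
        (∀ t < 0, ∀ x : (EuclideanSpace ℝ (Fin 3)), ‖fderiv ℝ (V t) x‖ ≤ L / (‖x‖ + Real.sqrt (-t)) ^ 2) ∧
        (∀ t < 0, ∀ x : (EuclideanSpace ℝ (Fin 3)), ‖iteratedFDeriv ℝ 2 (V t) x‖ ≤ L / (‖x‖ + Real.sqrt (-t)) ^ 3) ∧
        (∀ t < 0, ∀ x : (EuclideanSpace ℝ (Fin 3)), ‖deriv (fun s => V s x) t‖ ≤ L / (‖x‖ + Real.sqrt (-t)) ^ 3) ∧
        (∀ t < 0, ∀ x : (EuclideanSpace ℝ (Fin 3)), ‖gradient (Q t) x‖ ≤ L / (‖x‖ + Real.sqrt (-t)) ^ 3) := by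
  intro V C _ hV hd
  obtain ⟨Q, hQ⟩ := exists_isClassicalNSSolutionOn_Iio hV
  obtain ⟨L₁, hL₁0, hL₁⟩ := exists_norm_iteratedFDeriv_le_apex C
  obtain ⟨L₂, hL₂0, hL₂⟩ := exists_norm_deriv_le_apex C
  obtain ⟨L₃, hL₃0, hL₃⟩ := exists_norm_gradient_le_apex C
  set L : ℝ := L₁ + L₂ + L₃ with hL
  have hden : ∀ t < 0, ∀ x : (EuclideanSpace ℝ (Fin 3)), ∀ n : ℕ, 0 ≤ (‖x‖ + Real.sqrt (-t)) ^ n := fun t _ x n =>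
    pow_nonneg (add_nonneg (norm_nonneg _) (Real.sqrt_nonneg _)) n
  refine ⟨Q, L, by positivity, hQ, fun t ht x => ?_, fun t ht x => ?_, fun t ht x => ?_, fun t ht x => ?_⟩
  · have h := hL₁ hV hd 1 (by norm_num) t ht x
    rw [norm_iteratedFDeriv_one] at h
    exact h.trans (div_le_div_of_nonneg_right (by linarith) (hden t ht x 2))
  · exact (hL₁ hV hd 2 (by norm_num) t ht x).trans (div_le_div_of_nonneg_right (by linarith) (hden t ht x 3))
  · exact (hL₂ hV hd hQ t ht x).trans (div_le_div_of_nonneg_right (by linarith) (hden t ht x 3))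
  · exact (hL₃ hV hd hQ t ht x).trans (div_le_div_of_nonneg_right (by linarith) (hden t ht x 3))

/-! ## Registered sub-goal (helper stub of `stub_apexDerivativeBounds`) -/

/-- **Registered helper stub `stub_apexDerivativeBoundsGaugeFree`** (the gauge-free part of
`stub_apexDerivativeBounds`, crux stmt-NavierStokesRegularity-11717): classical on the whole open
slab with a jointly smooth pressure, and the four apex-weighted bounds on `∇V`, `D²V`, `∂ₜV`, `∇Q`.
[cite: KochNadirashviliSereginSverak2009, Prop. 4.1 (arXiv:0709.3599v1 p. 8)] [cite: SereginSverak2009, §2 p. 8] -/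
theorem stub_apexDerivativeBoundsGaugeFree :
    ∀ (V : ℝ → EuclideanSpace ℝ (Fin 3) → EuclideanSpace ℝ (Fin 3)) (C : ℝ), 0 < C →
      IsTypeIAncientMild C V → HasTypeIDecay C V →
      ∃ (Q : ℝ → EuclideanSpace ℝ (Fin 3) → ℝ) (L : ℝ), 0 ≤ L ∧
        IsClassicalNSSolutionOn (Iio (0 : ℝ)) 1 0 V Q ∧
        (∀ t < 0, ∀ x : EuclideanSpace ℝ (Fin 3), ‖fderiv ℝ (V t) x‖ ≤ L / (‖x‖ + Real.sqrt (-t)) ^ 2) ∧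
        (∀ t < 0, ∀ x : EuclideanSpace ℝ (Fin 3),
          ‖iteratedFDeriv ℝ 2 (V t) x‖ ≤ L / (‖x‖ + Real.sqrt (-t)) ^ 3) ∧
        (∀ t < 0, ∀ x : EuclideanSpace ℝ (Fin 3),
          ‖deriv (fun s => V s x) t‖ ≤ L / (‖x‖ + Real.sqrt (-t)) ^ 3) ∧
        (∀ t < 0, ∀ x : EuclideanSpace ℝ (Fin 3),
          ‖gradient (Q t) x‖ ≤ L / (‖x‖ + Real.sqrt (-t)) ^ 3) :=
  apexDerivativeBounds_gaugeFree

end Summit.NavierStokesRegularity.NavierStokesRegularity.Theorems.RellichScarScarRigidity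

end
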